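import Summits.BirchSwinnertonDyer.BirchSwinnertonDyer.Theses.PrintCf2
import Summits.BirchSwinnertonDyer.BirchSwinnertonDyer.Theses.CMKolyvaginAtInertTwo
import Summits.BirchSwinnertonDyer.Rank1Residual.P2.CMKolyvaginTamagawaIndexOddHeegner
import Literature.NumberTheory.EllipticCurves.ComplexMultiplicationHasCMThirteenProofs
import HarnessLib

/-!
# Crux `PrintCf2.InertOddHeegnerJOfFacts` (stmt-BirchSwinnertonDyer-20672) BY NAME from route `CMKolyvaginAtInertTwo`'s declared
# residual `OffHabitatCMResidualAtTwo` (stmt-BirchSwinnertonDyer-22838) — the inert odd-Heegner class is OFF the habitat `H₂` by its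
# Tamagawa index alone (`c_q = 2` at the CM prime on every member) — `--supports stmt-BirchSwinnertonDyer-20672`

Seat `leafhand-bsd-printcf2-2` g0 (prover, 2026-08-30; route `PrintCf2`, cell bus `pub/bsd-eis`). THEOREMS ONLY (0 definitions, 0 named
facts, 0 `sorry`); closes no item and no stub. BSD is proved for no curve by any of this.

WHY. The line card of 20672 (`Lines/oddheegner-birth.md`) places the class «OUTSIDE L8's habitat `H₂` (`CMKolyvaginAtInertTwo` requires an
odd Tamagawa product; here `c_q = 2` always) and INSIDE L8's declared residual `OffHabitatCMResidualAtTwo`». Seat ty2's kernel file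
`Rank1Residual/P2/CMKolyvaginTamagawaIndexOddHeegner.lean` (p597102) decided the Tamagawa index on the class:
`one_le_padicValNat_two_tamagawaProduct_of_j_oddHeegner` (`2 ∣ ∏ c_ℓ(W)` for every curve with one of the five `j`). This file books the
containment BY NAME, once: every `W` of the class has CM (`hasCM_of_j_eq_…`, Silverman App. C §11), analytic rank one, and an EVEN Tamagawa
product, so the habitat conjunct `Odd W.tamagawaProduct` fails and `OffHabitatCMResidualAtTwo` (22838; SPLIT on its own route into the
Tamagawa-shifted children `CMTamagawaDivisibilityAtInertTwo`, `CMShiftedPrimitiveSupplyAtInertTwo`, `CMKolyvaginExactAtInertTwoShifted`,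
`CMShiftedExactDescentAtTwo`, `CMTwinFactsAtTwo`, `OffShiftedHabitatCMResidualAtTwo` + glue) delivers `BSD(W,2)` — with NO use of 𝔅_inert.
Consequence for the planners (no route verb taken): closing 22838 (or its shifted children on the sub-class `t = v₂(∏ c_ℓ) = 1`, ty2's
`q`-silent twists) closes 20672 by `inertOddHeegnerJOfFacts_of_offHabitatCMResidualAtTwo`; the two registered stubs of line
`oddheegner-birth` follow verbatim (§2). [cite: SilvermanATAEC1994, IV.9.4 and Table 4.1] [cite: SilvermanAEC2009, App. C §11]
[cite: Jetchev2008GlobalDivisibility, Cor. 1.5 (shape of the Tamagawa-shifted bound)]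
-/

set_option autoImplicit false

-- D-0017 layout: summit = sub-problem, so `Summit.BirchSwinnertonDyer.BirchSwinnertonDyer.…` is the mandated namespace of Theorems files.
set_option linter.dupNamespace false

noncomputable section

namespace Summit.BirchSwinnertonDyer.BirchSwinnertonDyer.Theorems.PrintCf2.InertOddHeegnerOffHabitat

open WeierstrassCurve Literature.NumberTheory.EllipticCurves Literature.NumberTheory.EllipticCurves.Rank1Residual
  Summit.BirchSwinnertonDyer.BirchSwinnertonDyer.Theses.CMKolyvaginAtInertTwo
  Summit.BirchSwinnertonDyer.Rank1Residual.P2.OddHeegnerTwists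

/-! ### §1 The class is off the habitat `H₂`: an even Tamagawa product -/

/-- **The Tamagawa product of every curve of the class is EVEN** (`c_q = 2` at the CM prime: Kodaira `III`/`III*` since `Δ(A(q)^{(d)})` has
`q`-valuation `3` or `9`; ty2's `one_le_padicValNat_two_tamagawaProduct_of_j_oddHeegner`). [cite: SilvermanATAEC1994, IV.9.4 Steps 4 and 9 and Table 4.1]
[cite: Cremona1997, Table 1 (121b1, 361a1, 1849a1, 4489a1, 26569a1)] -/
theorem not_odd_tamagawaProduct_of_j_oddHeegner (W : WeierstrassCurve ℚ) [W.IsElliptic]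
    (hj : (W.j = -32768 ∨ W.j = -884736 ∨ W.j = -884736000 ∨ W.j = -147197952000 ∨ W.j = -262537412640768000)) : ¬ Odd W.tamagawaProduct := by
  have h1 : 1 ≤ padicValNat 2 W.tamagawaProduct := one_le_padicValNat_two_tamagawaProduct_of_j_oddHeegner W hj
  have h2 : 2 ∣ W.tamagawaProduct := dvd_of_one_le_padicValNat h1
  exact fun hodd ↦ (Nat.not_even_iff_odd.mpr hodd) (even_iff_two_dvd.mpr h2)

/-- **No curve of the class lies on the habitat `H₂`** of route `CMKolyvaginAtInertTwo` (the conjunct `Odd W.tamagawaProduct` fails; the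
other conjuncts — `CMInert W 2`, `ρ̄_{W,2}` onto, odd-Manin optimal frame — are not examined). [cite: SilvermanATAEC1994, IV.9.4 and Table 4.1] -/
theorem not_habitat_of_j_oddHeegner (W : WeierstrassCurve ℚ) [W.IsElliptic] [W.IsGloballyMinimal] [NeZero (W.conductorNorm ℤ)]
    (hj : (W.j = -32768 ∨ W.j = -884736 ∨ W.j = -884736000 ∨ W.j = -147197952000 ∨ W.j = -262537412640768000)) :
    ¬ (CMInert W 2 ∧ W.HasSurjectiveModNGaloisRep (2 : ℤ) ∧ Odd W.tamagawaProduct ∧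
      ∃ Dt : Literature.NumberTheory.EllipticCurves.ModularForms.ModularParametrizationData W (W.conductorNorm ℤ),
        (∀ z ∈ Dt.L.lattice, ∃ w ∈ Literature.NumberTheory.EllipticCurves.ModularForms.periodLattice Dt.f, z = (Dt.c : ℂ) * w) ∧
          Odd Dt.c) :=
  fun h ↦ not_odd_tamagawaProduct_of_j_oddHeegner W hj h.2.2.1

/-- **`BSD(W,2)` for every curve of the class from `OffHabitatCMResidualAtTwo` (22838).** The class member has CM (the five `j` are
rational CM `j`-invariants, `hasCM_of_j_eq_…` — the same case split as `InertOddHeegnerIndexTwo.hasCM_of_inertOddHeegnerJ`), analytic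
rank one, and is off the habitat (`not_habitat_of_j_oddHeegner`). [cite: SilvermanAEC2009, App. C §11] [cite: SilvermanATAEC1994, IV.9.4 and Table 4.1] -/
theorem bsdp_two_of_offHabitatCMResidualAtTwo_of_j_oddHeegner (hOff : OffHabitatCMResidualAtTwo)
    (W : WeierstrassCurve ℚ) [W.IsElliptic] [W.IsGloballyMinimal] (hr : W.analyticRank = 1)
    (hj : (W.j = -32768 ∨ W.j = -884736 ∨ W.j = -884736000 ∨ W.j = -147197952000 ∨ W.j = -262537412640768000)) : BSDp W 2 := by
  haveI : NeZero (W.conductorNorm ℤ) := ⟨W.conductorNorm_pos_holds.ne'⟩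
  have hCM : W.HasCM := by
    rcases hj with hj | hj | hj | hj | hj
    · exact WeierstrassCurve.hasCM_of_j_eq_neg32768 W hj
    · exact WeierstrassCurve.hasCM_of_j_eq_neg884736 W hj
    · exact WeierstrassCurve.hasCM_of_j_eq_neg884736000 W hj
    · exact WeierstrassCurve.hasCM_of_j_eq_neg147197952000 W hj
    · exact WeierstrassCurve.hasCM_of_j_eq_neg262537412640768000 W hj
  exact hOff W hCM hr (not_habitat_of_j_oddHeegner W hj)

/-! ### §2 Crux 20672 and its two registered stubs BY NAME from `OffHabitatCMResidualAtTwo` (22838) -/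

/-- **Crux `PrintCf2.InertOddHeegnerJOfFacts` (item 20672) from route `CMKolyvaginAtInertTwo`'s declared residual `OffHabitatCMResidualAtTwo`
(item 22838)** — unconditionally in 22838 (𝔅_inert is not used): each class member is a CM curve of analytic rank one off the habitat (§1).
[cite: SilvermanATAEC1994, IV.9.4 and Table 4.1] [cite: Miller2011LMS, Def. 1.1] -/
theorem inertOddHeegnerJOfFacts_of_offHabitatCMResidualAtTwo (hOff : OffHabitatCMResidualAtTwo) :
    Summit.BirchSwinnertonDyer.BirchSwinnertonDyer.Theses.PrintCf2.InertOddHeegnerJOfFacts := by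
  unfold Summit.BirchSwinnertonDyer.BirchSwinnertonDyer.Theses.PrintCf2.InertOddHeegnerJOfFacts
  intro _hB W _ _ hr hj
  exact bsdp_two_of_offHabitatCMResidualAtTwo_of_j_oddHeegner hOff W hr hj

/-- **Registered stub `stub_inertOddHeegner_goodAtTwo` of line `oddheegner-birth` (type VERBATIM, skeleton c7918dee93b5bc45) from 22838.**
[cite: Miller2011LMS, Def. 1.1] -/
theorem stub_inertOddHeegner_goodAtTwo_of_offHabitatCMResidualAtTwo (hOff : OffHabitatCMResidualAtTwo) :
    (Literature.NumberTheory.EllipticCurves.rank_eq_analyticRank_of_analyticRank_le_one ∧ WeierstrassCurve.hasEntireLFunction_rat ∧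
        WeierstrassCurve.bsdRHS_eq_of_isIsogenous ∧ Literature.NumberTheory.EllipticCurves.bsdTriple_of_hasCM_of_L_one_ne_zero ∧
        Literature.NumberTheory.EllipticCurves.KrizLi2019.thm112_bsdTwo_twist ∧
        Literature.NumberTheory.EllipticCurves.ShuZhai2021.thm12_ranks_of_twists ∧
        Literature.NumberTheory.EllipticCurves.ShuZhai2021.thm14_twoPartBSD_of_twists ∧
        Literature.NumberTheory.EllipticCurves.ShuZhai2021.thm410_twoAdicValuations_of_twists) →
      ∀ (W : WeierstrassCurve ℚ) [W.IsElliptic] [W.IsGloballyMinimal], W.analyticRank = 1 →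
        (W.j = -32768 ∨ W.j = -884736 ∨ W.j = -884736000 ∨ W.j = -147197952000 ∨ W.j = -262537412640768000) →
        Literature.NumberTheory.EllipticCurves.Rank1Residual.Good W 2 → BSDp W 2 := by
  intro _hB W _ _ hr hj _hg
  exact bsdp_two_of_offHabitatCMResidualAtTwo_of_j_oddHeegner hOff W hr hj

/-- **Registered stub `stub_inertOddHeegner_badAtTwo` of line `oddheegner-birth` (type VERBATIM, skeleton c7918dee93b5bc45) from 22838.**
[cite: Miller2011LMS, Def. 1.1] -/
theorem stub_inertOddHeegner_badAtTwo_of_offHabitatCMResidualAtTwo (hOff : OffHabitatCMResidualAtTwo) :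
    (Literature.NumberTheory.EllipticCurves.rank_eq_analyticRank_of_analyticRank_le_one ∧ WeierstrassCurve.hasEntireLFunction_rat ∧
        WeierstrassCurve.bsdRHS_eq_of_isIsogenous ∧ Literature.NumberTheory.EllipticCurves.bsdTriple_of_hasCM_of_L_one_ne_zero ∧
        Literature.NumberTheory.EllipticCurves.KrizLi2019.thm112_bsdTwo_twist ∧
        Literature.NumberTheory.EllipticCurves.ShuZhai2021.thm12_ranks_of_twists ∧
        Literature.NumberTheory.EllipticCurves.ShuZhai2021.thm14_twoPartBSD_of_twists ∧
        Literature.NumberTheory.EllipticCurves.ShuZhai2021.thm410_twoAdicValuations_of_twists) →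
      ∀ (W : WeierstrassCurve ℚ) [W.IsElliptic] [W.IsGloballyMinimal], W.analyticRank = 1 →
        (W.j = -32768 ∨ W.j = -884736 ∨ W.j = -884736000 ∨ W.j = -147197952000 ∨ W.j = -262537412640768000) →
        ¬ Literature.NumberTheory.EllipticCurves.Rank1Residual.Good W 2 → BSDp W 2 := by
  intro _hB W _ _ hr hj _hg
  exact bsdp_two_of_offHabitatCMResidualAtTwo_of_j_oddHeegner hOff W hr hj

end Summit.BirchSwinnertonDyer.BirchSwinnertonDyer.Theorems.PrintCf2.InertOddHeegnerOffHabitat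

end
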